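import Literature.AnabelianGeometry.SemiGraphs.ChartFibreCompletion
import Literature.AnabelianGeometry.SemiGraphs.TemperedAnabelian
import HarnessLib

/-!
# [SemiAnbd] Prop. 3.6 (iii) in the tree's `IsProfiniteCompletion` vocabulary:
# `π₁^temp(𝒢) → Aut(chart basepoint) = π̂₁(B(𝒢))` IS the profinite-completion map

Mochizuki, *Semi-graphs of anabelioids*, Publ. RIMS **42** (2006), Prop. 3.6 (iii) p. 38: "The full
embedding `B(G) ↪ B^temp(G)` induces an injection `π₁^temp(G) ↪ π̂₁(G)` of topological groups"
[cite: MochizukiSemiAnbd2006, Prop 3.6(iii) p.38]; §6 p. 69 reads `π̂₁(G)` as the profinite completion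
(`∧`).  PROOF-ONLY sequel (abc-iut L3, B7d) to `ChartFibreCompletion.lean`: for a chart `c` of
`π₁^temp(𝒢)` and the chart basepoint `Φ = chartFibreFin c _ _` of the Galois category `B(𝒢.toAnab)`,
the continuous homomorphism `ι = chartActionFin : π₁^temp(𝒢) → Aut Φ` satisfies the tree's FROZEN
predicate `IsProfiniteCompletion` (`TemperedAnabelian.lean`), i.e. the hypothesis shape `hPC` /
`isProfiniteCompletion_toHat` consumed BY NAME downstream ([IUTchI] Prop. 2.1/2.2 files, [EtTh] settings):

* `denseRange_chartActionFin` — DENSE RANGE for the topology of `Aut Φ` (from `chartActionFin_dense`: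
  basic open sets of `Aut Φ ⊆ ∏_X Aut Φ(X)` are cut out by finitely many objects);
* `autEmbedding_chartActionFin_quot_eq_one_iff` / `comap_autKer_chartToBObj_quot` — for an open normal
  subgroup `U` of finite index, the open normal subgroup `V_U = ker (Aut Φ → Aut Φ(X_U))`,
  `X_U := chartToBObj (π₁^temp(𝒢)/U)` the finite étale covering attached to the coset object, pulls back
  to EXACTLY `U` (equivariance of `chartFibreToBObjIso`);
* `isProfiniteCompletion_chartActionFin` — ASSEMBLY: `IsProfiniteCompletion ι` (compact / Hausdorff /
  totally disconnected `Aut Φ` are Mathlib's instances), and `…_of_prop36` /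
  `exists_isProfiniteCompletion_chart` under `Prop36Hypotheses` (a `ChartVertexDatum` exists by
  Thm. 3.7 (i), `nonempty_chartVertexDatum`);
* `injective_chartActionFin_iff` / `injective_chartActionFin_of_residuallyFinite` — the printed
  "injection": `ι` is injective iff the open normal subgroups of finite index of `π₁^temp(𝒢)` separate
  points, in particular under the named fact `TemperedPiResiduallyFinite` (typed form of (iii)).

No new definitions; nothing here takes a side on [IUTchIII] Cor. 3.12.
-/

noncomputable section

namespace Literature.AnabelianGeometry.SemiGraphs

open CategoryTheory CategoryTheory.Limits CategoryTheory.PreGaloisCategory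
open Literature.AnabelianGeometry.Anabelioids
open Literature.AnabelianGeometry.Anabelioids.Induction (quotObj basePt)
open Literature.AlgebraicGeometry.Frobenioids (BCat)
open scoped FintypeCatDiscrete Pointwise
open _root_.Topology

universe u

namespace ProfiniteSemiGraph

variable {𝒢 : ProfiniteSemiGraph.{u}}
variable (c : TemperedPiChart 𝒢) (h𝒢 : ∀ S : CovObj 𝒢, S.IsFinite → S.IsTempered)
variable (hfin : ∀ X : 𝒢.toAnab.BObj, Finite ((chartFibre c h𝒢).obj X))

/-! ### Dense range -/

/-- **DENSE RANGE** of `chartActionFin : π₁^temp(𝒢) → Aut(chart basepoint)` ([SemiAnbd] Prop. 3.6 (iii):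
`π̂₁(G)` is the profinite completion of `π₁^temp(G)`): a basic open neighbourhood in
`Aut Φ ⊆ ∏_X Aut Φ(X)` prescribes the components at finitely many objects, where `chartActionFin_dense`
supplies an element of `π₁^temp(𝒢)`. [cite: MochizukiSemiAnbd2006, Prop 3.6(iii) p.38] -/
theorem denseRange_chartActionFin (d : ChartVertexDatum c) :
    DenseRange (chartActionFin c h𝒢 hfin) := by
  classical
  intro σ
  rw [mem_closure_iff]
  intro o ho hσ
  obtain ⟨t, ht, rfl⟩ := isOpen_induced_iff.mp ho
  obtain ⟨I, w, hw, hIt⟩ := isOpen_pi_iff.mp ht (autEmbedding _ σ) hσ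
  obtain ⟨g, hg⟩ := chartActionFin_dense c h𝒢 d hfin σ I
  refine ⟨chartActionFin c h𝒢 hfin g, hIt (Set.mem_pi.mpr fun X hX => ?_), g, rfl⟩
  have happ : (chartActionFin c h𝒢 hfin g).app X = σ.app X := Iso.ext (hg X hX)
  rw [autEmbedding_apply, happ, ← autEmbedding_apply]
  exact (hw X hX).2

/-! ### The open normal subgroups of `Aut Φ` cutting out the finite-index open normal subgroups -/

/-- Continuity of the evaluation `Aut Φ → Aut Φ(X)`, `σ ↦ σ_X`, at one object (`Aut Φ(X)` discrete).
[cite: MochizukiSemiAnbd2006, Prop 3.6(iii) p.38] -/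
theorem continuous_autEmbedding_eval (X : 𝒢.toAnab.BObj) :
    Continuous fun σ : Aut (chartFibreFin c h𝒢 hfin) => autEmbedding (chartFibreFin c h𝒢 hfin) σ X :=
  (continuous_apply X).comp continuous_induced_dom

/-- The kernel of the evaluation `Aut Φ → Aut Φ(X)` at one object is OPEN (it is normal as a kernel).
[cite: MochizukiSemiAnbd2006, Prop 3.6(iii) p.38] -/
theorem isOpen_ker_eval_autEmbedding (X : 𝒢.toAnab.BObj) :
    IsOpen (((Pi.evalMonoidHom (fun Y => Aut ((chartFibreFin c h𝒢 hfin).obj Y)) X).comp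
      (autEmbedding (chartFibreFin c h𝒢 hfin))).ker : Set (Aut (chartFibreFin c h𝒢 hfin))) := by
  have h : (((Pi.evalMonoidHom (fun Y => Aut ((chartFibreFin c h𝒢 hfin).obj Y)) X).comp
      (autEmbedding (chartFibreFin c h𝒢 hfin))).ker : Set (Aut (chartFibreFin c h𝒢 hfin))) =
      (fun σ : Aut (chartFibreFin c h𝒢 hfin) => autEmbedding (chartFibreFin c h𝒢 hfin) σ X) ⁻¹' {1} := by
    ext σ
    simp only [SetLike.mem_coe, MonoidHom.mem_ker, MonoidHom.coe_comp, Function.comp_apply,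
      Pi.evalMonoidHom_apply, Set.mem_preimage, Set.mem_singleton_iff]
  rw [h]
  exact (isOpen_discrete _).preimage (continuous_autEmbedding_eval c h𝒢 hfin X)

/-- `chartActionFin` and `chartAction` agree on elements (both act by `ρ`).
[cite: MochizukiSemiAnbd2006, Prop 3.6(iii) p.38] -/
theorem chartActionFin_hom_app_apply_eq (g : c.G) (X : 𝒢.toAnab.BObj)
    (y : (chartFibreFin c h𝒢 hfin).obj X) :
    (chartActionFin c h𝒢 hfin g).hom.app X y = (chartAction c h𝒢 g).hom.app X y := rfl

/-- For `g ∈ π₁^temp(𝒢)` and the finite étale covering `X_U = chartToBObj (π₁^temp(𝒢)/U)` attached to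
the coset object of an open normal subgroup `U` of finite index: `g` acts trivially on the chart fibre
of `X_U` iff `g ∈ U` (the chart fibre is, equivariantly, `π₁^temp(𝒢)/U` — `chartFibreToBObjIso`).
[cite: MochizukiSemiAnbd2006, Prop 3.6(iii) p.38] -/
theorem autEmbedding_chartActionFin_quot_eq_one_iff (d : ChartVertexDatum c)
    (U : OpenNormalSubgroup c.G) [Finite (c.G ⧸ U.toSubgroup)] (g : c.G) :
    autEmbedding (chartFibreFin c h𝒢 hfin) (chartActionFin c h𝒢 hfin g)
        ((chartToBObj c d).obj (quotObj U.toSubgroup U.isOpen')) = 1 ↔ g ∈ U.toSubgroup := by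
  -- `J : Φ(X_U) ≅ π₁^temp(𝒢)/U` and its inverse
  have hJ : ∀ y : (quotObj U.toSubgroup U.isOpen').obj.V,
      (chartFibreToBObjIso c h𝒢 d).hom.app (quotObj U.toSubgroup U.isOpen')
        ((chartFibreToBObjIso c h𝒢 d).inv.app (quotObj U.toSubgroup U.isOpen') y) = y :=
    fun y => Iso.inv_hom_id_app_apply (chartFibreToBObjIso c h𝒢 d) (quotObj U.toSubgroup U.isOpen') y
  have hJ' : ∀ x : (chartToBObj c d ⋙ chartFibre c h𝒢).obj (quotObj U.toSubgroup U.isOpen'),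
      (chartFibreToBObjIso c h𝒢 d).inv.app (quotObj U.toSubgroup U.isOpen')
        ((chartFibreToBObjIso c h𝒢 d).hom.app (quotObj U.toSubgroup U.isOpen') x) = x :=
    fun x => Iso.hom_inv_id_app_apply (chartFibreToBObjIso c h𝒢 d) (quotObj U.toSubgroup U.isOpen') x
  -- the action on the coset object is the coset action
  have hρ : ∀ h : c.G,
      ConcreteCategory.hom ((quotObj U.toSubgroup U.isOpen').obj.ρ g)
        (((h : c.G ⧸ U.toSubgroup)) : (quotObj U.toSubgroup U.isOpen').obj.V) =
      (((g * h : c.G) : c.G ⧸ U.toSubgroup) : (quotObj U.toSubgroup U.isOpen').obj.V) := fun h => rfl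
  -- reformulation of the left-hand side on elements of the chart fibre
  have key : autEmbedding (chartFibreFin c h𝒢 hfin) (chartActionFin c h𝒢 hfin g)
        ((chartToBObj c d).obj (quotObj U.toSubgroup U.isOpen')) = 1 ↔
      ∀ x : (chartToBObj c d ⋙ chartFibre c h𝒢).obj (quotObj U.toSubgroup U.isOpen'),
        (chartAction c h𝒢 g).hom.app ((chartToBObj c d).obj (quotObj U.toSubgroup U.isOpen')) x = x := by
    constructor
    · intro h1 x
      have h2 : (chartActionFin c h𝒢 hfin g).hom.app
          ((chartToBObj c d).obj (quotObj U.toSubgroup U.isOpen')) = 𝟙 _ := by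
        rw [← Iso.app_hom, ← autEmbedding_apply, h1]
        rfl
      have h3 := ConcreteCategory.congr_hom h2 x
      rw [FintypeCat.id_apply] at h3
      exact h3
    · intro hx
      apply Iso.ext
      rw [autEmbedding_apply, Iso.app_hom]
      change (chartActionFin c h𝒢 hfin g).hom.app
          ((chartToBObj c d).obj (quotObj U.toSubgroup U.isOpen')) = 𝟙 _
      apply ConcreteCategory.hom_ext
      intro x
      rw [FintypeCat.id_apply]
      exact hx x
  rw [key]
  constructor
  · intro hx
    -- evaluate at `x₀ = J⁻¹(eU)`: `eU = J (g • x₀) = g • eU`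
    have h2 := chartFibreToBObjIso_equivariant c h𝒢 d g (quotObj U.toSubgroup U.isOpen')
      ((chartFibreToBObjIso c h𝒢 d).inv.app _ (basePt U.toSubgroup U.isOpen'))
    rw [hx, hJ] at h2
    have h3 : (((1 : c.G) : c.G ⧸ U.toSubgroup) : (quotObj U.toSubgroup U.isOpen').obj.V) =
        (((g * 1 : c.G) : c.G ⧸ U.toSubgroup) : (quotObj U.toSubgroup U.isOpen').obj.V) :=
      h2.trans (hρ 1)
    rw [mul_one] at h3
    have h4 : ((1 : c.G) : c.G ⧸ U.toSubgroup) = (g : c.G ⧸ U.toSubgroup) := h3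
    rw [QuotientGroup.eq, inv_one, one_mul] at h4
    exact h4
  · intro hg x
    -- compare after `J`: `J (g • x) = g • J x = J x` since `g ∈ U ⊴ π₁^temp(𝒢)`
    obtain ⟨h, hh⟩ := QuotientGroup.mk_surjective
      ((chartFibreToBObjIso c h𝒢 d).hom.app (quotObj U.toSubgroup U.isOpen') x :
        c.G ⧸ U.toSubgroup)
    have h2 := chartFibreToBObjIso_equivariant c h𝒢 d g (quotObj U.toSubgroup U.isOpen') x
    have h3 : ConcreteCategory.hom ((quotObj U.toSubgroup U.isOpen').obj.ρ g)
        ((chartFibreToBObjIso c h𝒢 d).hom.app (quotObj U.toSubgroup U.isOpen') x) =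
        (chartFibreToBObjIso c h𝒢 d).hom.app (quotObj U.toSubgroup U.isOpen') x := by
      have hx : (chartFibreToBObjIso c h𝒢 d).hom.app (quotObj U.toSubgroup U.isOpen') x =
          (((h : c.G ⧸ U.toSubgroup)) : (quotObj U.toSubgroup U.isOpen').obj.V) := hh.symm
      rw [hx, hρ h]
      change (((g * h : c.G) : c.G ⧸ U.toSubgroup)) = ((h : c.G ⧸ U.toSubgroup))
      rw [QuotientGroup.eq, mul_inv_rev]
      exact U.isNormal'.conj_mem' g⁻¹ (U.toSubgroup.inv_mem hg) h
    rw [h3] at h2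
    have h4 := congrArg ((chartFibreToBObjIso c h𝒢 d).inv.app (quotObj U.toSubgroup U.isOpen')) h2
    rw [hJ', hJ'] at h4
    exact h4

/-- **`comap ι V_U = U`**: the open normal subgroup `V_U = ker (Aut Φ → Aut Φ(X_U))` of `Aut Φ` pulls back
along `chartActionFin` to exactly the open normal subgroup `U` of finite index of `π₁^temp(𝒢)`.
[cite: MochizukiSemiAnbd2006, Prop 3.6(iii) p.38] -/
theorem comap_autKer_chartToBObj_quot (d : ChartVertexDatum c)
    (U : OpenNormalSubgroup c.G) [Finite (c.G ⧸ U.toSubgroup)] :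
    ((Pi.evalMonoidHom (fun Y => Aut ((chartFibreFin c h𝒢 hfin).obj Y))
        ((chartToBObj c d).obj (quotObj U.toSubgroup U.isOpen'))).comp
      (autEmbedding (chartFibreFin c h𝒢 hfin))).ker.comap (chartActionFin c h𝒢 hfin) =
      U.toSubgroup := by
  ext g
  rw [Subgroup.mem_comap, MonoidHom.mem_ker, MonoidHom.comp_apply, Pi.evalMonoidHom_apply]
  exact autEmbedding_chartActionFin_quot_eq_one_iff c h𝒢 hfin d U g

/-- **Every open normal subgroup of finite index of `π₁^temp(𝒢)` is cut out by an open normal subgroup of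
`Aut Φ`** (the clause `comap_surjective` of `IsProfiniteCompletion`).
[cite: MochizukiSemiAnbd2006, Prop 3.6(iii) p.38] -/
theorem exists_openNormal_comap_chartActionFin_eq (d : ChartVertexDatum c)
    (U : OpenNormalSubgroup c.G) [Finite (c.G ⧸ U.toSubgroup)] :
    ∃ V : OpenNormalSubgroup (Aut (chartFibreFin c h𝒢 hfin)),
      U.toSubgroup = V.toSubgroup.comap (chartActionFin c h𝒢 hfin) :=
  ⟨{ toSubgroup := ((Pi.evalMonoidHom (fun Y => Aut ((chartFibreFin c h𝒢 hfin).obj Y))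
        ((chartToBObj c d).obj (quotObj U.toSubgroup U.isOpen'))).comp
        (autEmbedding (chartFibreFin c h𝒢 hfin))).ker,
     isOpen' := isOpen_ker_eval_autEmbedding c h𝒢 hfin _ },
    (comap_autKer_chartToBObj_quot c h𝒢 hfin d U).symm⟩

/-! ### Assembly: `IsProfiniteCompletion` -/

/-- **[SemiAnbd] Prop. 3.6 (iii) in the `IsProfiniteCompletion` vocabulary**: for a chart `c` of
`π₁^temp(𝒢)` carrying a `ChartVertexDatum` (connected `𝒢`, a verticial homomorphism — Thm. 3.7 (i)),
the continuous homomorphism `chartActionFin : π₁^temp(𝒢) → Aut(chart basepoint of B(𝒢))` exhibits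
`Aut Φ = π̂₁(B(𝒢))` as THE PROFINITE COMPLETION of `π₁^temp(𝒢)`: `Aut Φ` is compact Hausdorff totally
disconnected, the image is dense, and the open normal subgroups of finite index of `π₁^temp(𝒢)` are
exactly the pull-backs of the open normal subgroups of `Aut Φ`.
[cite: MochizukiSemiAnbd2006, Prop 3.6(iii) p.38] -/
theorem isProfiniteCompletion_chartActionFin (d : ChartVertexDatum c) :
    IsProfiniteCompletion
      ({ toMonoidHom := chartActionFin c h𝒢 hfin,
         continuous_toFun := continuous_chartActionFin c h𝒢 hfin } :
        c.G →ₜ* Aut (chartFibreFin c h𝒢 hfin)) where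
  compactSpace := inferInstance
  t2Space := inferInstance
  totallyDisconnectedSpace := inferInstance
  denseRange := denseRange_chartActionFin c h𝒢 hfin d
  comap_surjective U hU := by
    haveI : U.toSubgroup.FiniteIndex := hU
    haveI : Finite (c.G ⧸ U.toSubgroup) := Subgroup.finite_quotient_of_finiteIndex
    exact exists_openNormal_comap_chartActionFin_eq c h𝒢 hfin d U
  isOpen_comap V := V.isOpen'.preimage (continuous_chartActionFin c h𝒢 hfin)

/-- **Injectivity criterion** ([SemiAnbd] Prop. 3.6 (iii), "induces an injection"): `chartActionFin` is
injective iff the open normal subgroups of finite index of `π₁^temp(𝒢)` separate points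
(residual finiteness — the KERNEL clause `chartActionFin_eq_one_iff`).
[cite: MochizukiSemiAnbd2006, Prop 3.6(iii) p.38] -/
theorem injective_chartActionFin_iff (d : ChartVertexDatum c) :
    Function.Injective (chartActionFin c h𝒢 hfin) ↔
      ∀ g : c.G, (∀ N : OpenNormalSubgroup c.G, Finite (c.G ⧸ N.toSubgroup) → g ∈ N.toSubgroup) →
        g = 1 := by
  rw [← MonoidHom.ker_eq_bot_iff, Subgroup.eq_bot_iff_forall]
  refine forall_congr' fun g => ?_
  rw [MonoidHom.mem_ker, chartActionFin_eq_one_iff c h𝒢 d hfin g]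

/-! ### Under the hypotheses of Proposition 3.6 -/

/-- **[SemiAnbd] Prop. 3.6 (iii), `IsProfiniteCompletion` form, under `Prop36Hypotheses`** (the
`ChartVertexDatum` exists by Thm. 3.7 (i), `nonempty_chartVertexDatum`; finite objects are tempered by
`isTempered_of_isFinite_of_prop36`). [cite: MochizukiSemiAnbd2006, Prop 3.6(iii) p.38] -/
theorem isProfiniteCompletion_chartActionFin_of_prop36 (h36 : 𝒢.Prop36Hypotheses)
    (c : TemperedPiChart 𝒢)
    (hfin : ∀ X : 𝒢.toAnab.BObj, Finite ((chartFibre c (isTempered_of_isFinite_of_prop36 h36)).obj X)) :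
    IsProfiniteCompletion
      ({ toMonoidHom := chartActionFin c (isTempered_of_isFinite_of_prop36 h36) hfin,
         continuous_toFun :=
           continuous_chartActionFin c (isTempered_of_isFinite_of_prop36 h36) hfin } :
        c.G →ₜ* Aut (chartFibreFin c (isTempered_of_isFinite_of_prop36 h36) hfin)) := by
  obtain ⟨d⟩ := nonempty_chartVertexDatum h36 c
  exact isProfiniteCompletion_chartActionFin c _ hfin d

/-- **[SemiAnbd] Prop. 3.6 (iii)** — EXISTENCE PACKAGE under `Prop36Hypotheses`: for every chart `c` of
`π₁^temp(𝒢)` the chart basepoint `Φ` is a fibre functor of `B(𝒢.toAnab)` (so `Aut Φ` is a model of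
`π̂₁(B(𝒢))`) and `chartActionFin : π₁^temp(𝒢) → Aut Φ` is the profinite-completion map
(`IsProfiniteCompletion`); it is moreover injective as soon as the open normal subgroups of finite
index separate points (`injective_chartActionFin_of_residuallyFinite`).
[cite: MochizukiSemiAnbd2006, Prop 3.6(iii) p.38] -/
theorem exists_isProfiniteCompletion_chart (h36 : 𝒢.Prop36Hypotheses) (c : TemperedPiChart 𝒢) :
    letI := 𝒢.toAnab.preGaloisCategory_bObj
    ∃ hfin : ∀ X : 𝒢.toAnab.BObj,
        Finite ((chartFibre c (isTempered_of_isFinite_of_prop36 h36)).obj X),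
      Nonempty (FiberFunctor (chartFibreFin c (isTempered_of_isFinite_of_prop36 h36) hfin)) ∧
      IsProfiniteCompletion
        ({ toMonoidHom := chartActionFin c (isTempered_of_isFinite_of_prop36 h36) hfin,
           continuous_toFun :=
             continuous_chartActionFin c (isTempered_of_isFinite_of_prop36 h36) hfin } :
          c.G →ₜ* Aut (chartFibreFin c (isTempered_of_isFinite_of_prop36 h36) hfin)) := by
  letI := 𝒢.toAnab.preGaloisCategory_bObj
  obtain ⟨d⟩ := nonempty_chartVertexDatum h36 c
  have hfin : ∀ X : 𝒢.toAnab.BObj,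
      Finite ((chartFibre c (isTempered_of_isFinite_of_prop36 h36)).obj X) :=
    fun X => finite_chartFibre c _ d.v d.ψ d.e X
  exact ⟨hfin, nonempty_fiberFunctor_chartFibreFin c _ hfin ⟨h36.isConnected⟩ d.v d.ψ d.e,
    isProfiniteCompletion_chartActionFin c _ hfin d⟩

/-- **"induces an injection `π₁^temp(G) ↪ π̂₁(G)`"** ([SemiAnbd] Prop. 3.6 (iii) as printed), from the
typed named fact `TemperedPiResiduallyFinite` (the open normal subgroups of finite index of
`π₁^temp(𝒢)` separate points): `chartActionFin` is injective.
[cite: MochizukiSemiAnbd2006, Prop 3.6(iii) p.38] -/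
theorem injective_chartActionFin_of_residuallyFinite (hRF : TemperedPiResiduallyFinite.{u})
    (h36 : 𝒢.Prop36Hypotheses) (c : TemperedPiChart 𝒢)
    (hfin : ∀ X : 𝒢.toAnab.BObj, Finite ((chartFibre c (isTempered_of_isFinite_of_prop36 h36)).obj X)) :
    Function.Injective (chartActionFin c (isTempered_of_isFinite_of_prop36 h36) hfin) := by
  obtain ⟨d⟩ := nonempty_chartVertexDatum h36 c
  rw [injective_chartActionFin_iff c _ hfin d]
  intro g hg
  by_contra hne
  obtain ⟨N, hN, hgN⟩ := hRF 𝒢 h36 c g hne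
  exact hgN (hg N hN)

end ProfiniteSemiGraph

end Literature.AnabelianGeometry.SemiGraphs

end
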